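import Literature.RingTheory.MvPowerSeries.MonoidPowerSeriesGenerators
import HarnessLib

/-!
# Faces and rank of finitely generated monoids of exponents

`Literature/RingTheory/MvPowerSeries/MonoidPowerSeriesFaces.lean`. Combinatorics of a submonoid
`P ⊆ ℕ^{(σ)}` used in the dimension theory of the completed monoid algebras `R⟦P⟧` of
`MonoidPowerSeries.lean` (K. Kato, *Toric singularities*, Amer. J. Math. 116 (1994), §5:
ideals, prime ideals and faces of monoids, `dim P`; a *face* of `P` is a submonoid `F` with
`a + b ∈ F ⇒ a, b ∈ F`, i.e. the complement of a prime ideal of `P`, (5.1)–(5.3)). PROVED here: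

* `IsFace F P`; faces are closed under taking summands of sums (`IsFace.mem_of_sum_mem`) and
  under division by positive integers (`IsFace.mem_of_nsmul_mem`); a face of a finitely
  generated `P` is generated by the generators of `P` it contains (`IsFace.eq_closure_generators`),
  hence is finitely generated (`IsFace.fg`);
* `rank P` — the dimension of the `ℚ`-span of `P` in `ℚ^σ` (`= rank_ℤ Pᵍᵖ = dim P` of Kato
  (5.4)–(5.5) for saturated `P`); `rank_mono`; and the key strict inequality
  `rank_lt_of_isFace` : a PROPER face has strictly smaller rank (if the spans agree, some
  positive multiple of any `p ∈ P` differs from an element of `F` by an element of `F`, and the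
  face property forces `p ∈ F`).

References: [Kato1994] K. Kato, Toric singularities, Amer. J. Math. 116 (1994), §5
((5.1)–(5.5)).
-/

noncomputable section

open MvPowerSeries

namespace Literature.RingTheory.MvPowerSeries

namespace monoidPowerSeries

universe u v

variable {σ : Type u}

/-! ### Faces -/

/-- A **face** of a monoid `P ⊆ ℕ^{(σ)}` of exponents: a submonoid `F ⊆ P` such that a sum of two
elements of `P` lies in `F` only if both summands do (the complement `P ∖ F` is then a prime
ideal of `P`, Kato (5.1)). [cite: Kato1994, (5.1)–(5.3)] -/
structure IsFace (F P : AddSubmonoid (σ →₀ ℕ)) : Prop where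
  /-- a face is a submonoid of `P` -/
  le : F ≤ P
  /-- if `a + b ∈ F` with `a, b ∈ P` then `a ∈ F` -/
  mem_of_add_mem : ∀ a ∈ P, ∀ b ∈ P, a + b ∈ F → a ∈ F

namespace IsFace

variable {F P : AddSubmonoid (σ →₀ ℕ)}

/-- `P` is a face of itself. [cite: Kato1994, (5.1)–(5.3)] -/
theorem refl (P : AddSubmonoid (σ →₀ ℕ)) : IsFace P P :=
  ⟨le_rfl, fun _ ha _ _ _ => ha⟩

/-- The second summand of a sum in a face lies in the face. [cite: Kato1994, (5.1)–(5.3)] -/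
theorem mem_of_add_mem' (h : IsFace F P) {a b : σ →₀ ℕ} (ha : a ∈ P) (hb : b ∈ P)
    (hab : a + b ∈ F) : b ∈ F :=
  h.mem_of_add_mem b hb a ha (by rwa [add_comm])

/-- Faces are closed under taking summands of finite sums. [cite: Kato1994, (5.1)–(5.3)] -/
theorem mem_of_sum_mem (h : IsFace F P) {ι : Type*} (s : Finset ι) (a : ι → (σ →₀ ℕ))
    (ha : ∀ i ∈ s, a i ∈ P) (hs : ∑ i ∈ s, a i ∈ F) : ∀ i ∈ s, a i ∈ F := by
  classical
  induction s using Finset.induction_on with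
  | empty => intro i hi; exact absurd hi (Finset.notMem_empty i)
  | insert j t hj ih =>
    rw [Finset.sum_insert hj] at hs
    have hjP : a j ∈ P := ha j (Finset.mem_insert_self j t)
    have htP : ∑ i ∈ t, a i ∈ P :=
      P.sum_mem fun i hi => ha i (Finset.mem_insert_of_mem hi)
    have hjF : a j ∈ F := h.mem_of_add_mem _ hjP _ htP hs
    have htF : ∑ i ∈ t, a i ∈ F := h.mem_of_add_mem' hjP htP hs
    intro i hi
    rcases Finset.mem_insert.1 hi with rfl | hi
    · exact hjF
    · exact ih (fun k hk => ha k (Finset.mem_insert_of_mem hk)) htF i hi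

/-- Faces are closed under division by positive integers: `n • a ∈ F`, `n ≠ 0`, `a ∈ P` imply
`a ∈ F`. [cite: Kato1994, (5.1)–(5.3)] -/
theorem mem_of_nsmul_mem (h : IsFace F P) {a : σ →₀ ℕ} (ha : a ∈ P) {n : ℕ} (hn : n ≠ 0)
    (hna : n • a ∈ F) : a ∈ F := by
  obtain ⟨k, rfl⟩ := Nat.exists_eq_succ_of_ne_zero hn
  rw [succ_nsmul] at hna
  exact h.mem_of_add_mem' (P.nsmul_mem ha k) ha hna

/-- A face of `P = ⟨g_i⟩` is generated by the generators `g_i` that it contains.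
[cite: Kato1994, (5.1)–(5.3)] -/
theorem eq_closure_generators (h : IsFace F P) {ι : Type*} (g : ι → (σ →₀ ℕ))
    (hP : AddSubmonoid.closure (Set.range g) = P) :
    F = AddSubmonoid.closure (g '' {i | g i ∈ F}) := by
  classical
  refine le_antisymm ?_ (AddSubmonoid.closure_le.2 ?_)
  · intro q hq
    obtain ⟨d, hd⟩ := exists_expSum_eq_of_mem_closure g (hP.symm ▸ h.le hq : q ∈ _)
    -- `q = ∑ d_i • g_i`; every summand lies in `F`
    have hsum : ∑ i ∈ d.support, d i • g i ∈ F := by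
      have : expSum g d = ∑ i ∈ d.support, d i • g i := rfl
      rw [← this, hd]; exact hq
    have hmem : ∀ i ∈ d.support, d i • g i ∈ F :=
      h.mem_of_sum_mem d.support (fun i => d i • g i)
        (fun i _ => P.nsmul_mem (hP ▸ AddSubmonoid.subset_closure ⟨i, rfl⟩) _) hsum
    rw [← hd]
    change ∑ i ∈ d.support, d i • g i ∈ _
    refine AddSubmonoid.sum_mem _ fun i hi => AddSubmonoid.nsmul_mem _ ?_ _
    refine AddSubmonoid.subset_closure ⟨i, ?_, rfl⟩
    exact h.mem_of_nsmul_mem (hP ▸ AddSubmonoid.subset_closure ⟨i, rfl⟩)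
      (Finsupp.mem_support_iff.1 hi) (hmem i hi)
  · rintro _ ⟨i, hi, rfl⟩
    exact hi

/-- A face of a finitely generated monoid of exponents is finitely generated.
[cite: Kato1994, (5.1)–(5.3)] -/
theorem fg (h : IsFace F P) (hP : P.FG) : F.FG := by
  classical
  obtain ⟨S, hS⟩ := hP
  have hS' : AddSubmonoid.closure (Set.range (fun x : S => (x : σ →₀ ℕ))) = P := by
    rw [← hS]; congr 1; ext x; simp
  refine ⟨S.filter (fun x => x ∈ F), ?_⟩
  conv_rhs => rw [h.eq_closure_generators (fun x : S => (x : σ →₀ ℕ)) hS']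
  congr 1
  ext y
  simp only [Finset.coe_filter, Set.mem_setOf_eq, Set.mem_image]
  constructor
  · rintro ⟨hyS, hyF⟩
    exact ⟨⟨y, hyS⟩, hyF, rfl⟩
  · rintro ⟨x, hx, rfl⟩
    exact ⟨x.2, hx⟩

end IsFace

/-! ### Rank -/

/-- The embedding `ℕ^{(σ)} → ℚ^σ` of exponents into rational vectors. [cite: Kato1994, §5] -/
def toRatVec : (σ →₀ ℕ) →+ (σ → ℚ) where
  toFun p := fun s => (p s : ℚ)
  map_zero' := by ext s; simp
  map_add' p q := by ext s; simp

/-- `toRatVec` on a coordinate. [cite: Kato1994, §5] -/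
@[simp] theorem toRatVec_apply (p : σ →₀ ℕ) (s : σ) : toRatVec p s = (p s : ℚ) := rfl

/-- `toRatVec` is injective. [cite: Kato1994, §5] -/
theorem toRatVec_injective : Function.Injective (toRatVec (σ := σ)) := by
  intro p q hpq
  ext s
  have := congrFun hpq s
  simpa using this

/-- The **rank** of a monoid of exponents `P ⊆ ℕ^{(σ)}` (`σ` finite): the dimension of its
`ℚ`-linear span in `ℚ^σ` (`= rank_ℤ Pᵍᵖ`; for fs monoids Kato's `dim P`, (5.4)–(5.5)).
[cite: Kato1994, (5.4)–(5.5)] -/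
def rank (P : AddSubmonoid (σ →₀ ℕ)) : ℕ :=
  Module.finrank ℚ (Submodule.span ℚ (toRatVec '' (P : Set (σ →₀ ℕ))))

/-- The rank is monotone. [cite: Kato1994, (5.4)–(5.5)] -/
theorem rank_mono [Finite σ] {F P : AddSubmonoid (σ →₀ ℕ)} (h : F ≤ P) : rank F ≤ rank P :=
  Submodule.finrank_mono (Submodule.span_mono (Set.image_mono h))

/-- The zero monoid has rank `0`. [cite: Kato1994, (5.4)–(5.5)] -/
theorem rank_bot : rank (⊥ : AddSubmonoid (σ →₀ ℕ)) = 0 := by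
  rw [rank, AddSubmonoid.coe_bot, Set.image_singleton, map_zero, Submodule.span_zero_singleton,
    finrank_bot]

/-- Elements of the `ℚ`-span of a submonoid `F` of exponents: some positive integer multiple is a
difference of two elements of `F`. [cite: Kato1994, §5] -/
theorem exists_nsmul_eq_sub_of_mem_span {F : AddSubmonoid (σ →₀ ℕ)} {y : σ → ℚ}
    (hy : y ∈ Submodule.span ℚ (toRatVec '' (F : Set (σ →₀ ℕ)))) :
    ∃ N : ℕ, 0 < N ∧ ∃ u ∈ F, ∃ w ∈ F, (N : ℚ) • y = toRatVec u - toRatVec w := by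
  induction hy using Submodule.span_induction with
  | mem x hx =>
    obtain ⟨f, hf, rfl⟩ := hx
    exact ⟨1, one_pos, f, hf, 0, F.zero_mem, by simp⟩
  | zero => exact ⟨1, one_pos, 0, F.zero_mem, 0, F.zero_mem, by simp⟩
  | add x y _ _ hx hy =>
    obtain ⟨N₁, hN₁, u₁, hu₁, w₁, hw₁, h₁⟩ := hx
    obtain ⟨N₂, hN₂, u₂, hu₂, w₂, hw₂, h₂⟩ := hy
    refine ⟨N₁ * N₂, Nat.mul_pos hN₁ hN₂, N₂ • u₁ + N₁ • u₂, F.add_mem (F.nsmul_mem hu₁ _)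
      (F.nsmul_mem hu₂ _), N₂ • w₁ + N₁ • w₂, F.add_mem (F.nsmul_mem hw₁ _) (F.nsmul_mem hw₂ _),
      ?_⟩
    have hx' : ((N₁ * N₂ : ℕ) : ℚ) • x = (N₂ : ℚ) • (toRatVec u₁ - toRatVec w₁) := by
      rw [← h₁, smul_smul, Nat.cast_mul, mul_comm]
    have hy' : ((N₁ * N₂ : ℕ) : ℚ) • y = (N₁ : ℚ) • (toRatVec u₂ - toRatVec w₂) := by
      rw [← h₂, smul_smul, Nat.cast_mul]
    rw [smul_add, hx', hy']
    simp only [map_add, map_nsmul, smul_sub, Nat.cast_smul_eq_nsmul]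
    abel
  | smul q x _ hx =>
    obtain ⟨N, hN, u, hu, w, hw, h⟩ := hx
    -- `(N * den q) • (q • x) = num q • (N • x)`
    refine ⟨N * q.den, Nat.mul_pos hN q.den_pos, ?_⟩
    have hq : (q.den : ℚ) * q = q.num := Rat.den_mul_eq_num q
    have key : ((N * q.den : ℕ) : ℚ) • (q • x) = (q.num : ℚ) • (toRatVec u - toRatVec w) := by
      rw [← h, smul_smul, smul_smul, Nat.cast_mul, mul_assoc, hq, mul_comm]
    rcases le_or_gt 0 q.num with hpos | hneg
    · obtain ⟨a, ha⟩ := Int.eq_ofNat_of_zero_le hpos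
      refine ⟨a • u, F.nsmul_mem hu _, a • w, F.nsmul_mem hw _, ?_⟩
      rw [key, ha, map_nsmul, map_nsmul, Int.cast_natCast, Nat.cast_smul_eq_nsmul, smul_sub]
    · obtain ⟨a, ha⟩ := Int.exists_eq_neg_ofNat (le_of_lt hneg)
      refine ⟨a • w, F.nsmul_mem hw _, a • u, F.nsmul_mem hu _, ?_⟩
      rw [key, ha, map_nsmul, map_nsmul, Int.cast_neg, Int.cast_natCast, neg_smul,
        Nat.cast_smul_eq_nsmul, smul_sub]
      abel

/-- **A proper face has strictly smaller rank.** If `F` is a face of `P` and `p ∈ P ∖ F`, then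
`rank F < rank P`: otherwise the spans agree, `N • p = u - w` with `u, w ∈ F`, `N ≥ 1`, so
`N • p + w = u ∈ F` and the face property gives `N • p ∈ F`, then `p ∈ F`.
[cite: Kato1994, (5.4)–(5.5)] -/
theorem rank_lt_of_isFace [Finite σ] {F P : AddSubmonoid (σ →₀ ℕ)} (h : IsFace F P)
    {p : σ →₀ ℕ} (hpP : p ∈ P) (hpF : p ∉ F) : rank F < rank P := by
  refine lt_of_le_of_ne (rank_mono h.le) fun heq => hpF ?_
  have hle : Submodule.span ℚ (toRatVec '' (F : Set (σ →₀ ℕ))) ≤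
      Submodule.span ℚ (toRatVec '' (P : Set (σ →₀ ℕ))) :=
    Submodule.span_mono (Set.image_mono h.le)
  have hspan := Submodule.eq_of_le_of_finrank_eq hle heq
  have hp : toRatVec p ∈ Submodule.span ℚ (toRatVec '' (F : Set (σ →₀ ℕ))) := by
    rw [hspan]; exact Submodule.subset_span ⟨p, hpP, rfl⟩
  obtain ⟨N, hN, u, hu, w, hw, hNp⟩ := exists_nsmul_eq_sub_of_mem_span hp
  have hsum : N • p + w = u := by
    apply toRatVec_injective
    rw [map_add, map_nsmul, ← Nat.cast_smul_eq_nsmul ℚ, hNp, sub_add_cancel]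
  have hNpF : N • p ∈ F := h.mem_of_add_mem _ (P.nsmul_mem hpP N) _ (h.le hw) (hsum ▸ hu)
  exact h.mem_of_nsmul_mem hpP (Nat.pos_iff_ne_zero.1 hN) hNpF

/-- A face of strictly smaller rank than... (contrapositive packaging): a face of `P` distinct
from `P` has smaller rank. [cite: Kato1994, (5.4)–(5.5)] -/
theorem rank_lt_of_isFace_of_ne [Finite σ] {F P : AddSubmonoid (σ →₀ ℕ)} (h : IsFace F P)
    (hne : F ≠ P) : rank F < rank P := by
  obtain ⟨p, hpP, hpF⟩ : ∃ p ∈ P, p ∉ F := by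
    by_contra hcon
    exact hne (le_antisymm h.le fun p hp => Classical.not_not.1 fun hpF => hcon ⟨p, hp, hpF⟩)
  exact rank_lt_of_isFace h hpP hpF

end monoidPowerSeries

end Literature.RingTheory.MvPowerSeries
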